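import Literature.NumberTheory.EllipticCurves.TateModuleBigImageOfSurjectiveProofs
import Literature.NumberTheory.GaloisRepresentations.AbsGaloisGroupCompact
import Summits.BirchSwinnertonDyer.BirchSwinnertonDyer.Theorems.UniversalToricDescentTwinThreeAdicImageOverK
import Summits.BirchSwinnertonDyer.BirchSwinnertonDyer.Theorems.UniversalToricDescentTwinSplitIMCAtThreeGoodOrdOfYanZhu
import HarnessLib

/-!
# `Γ_K → Aut_{ℤ₃}(T₃E)` is ONTO for every UTD twin (Howard 2004 Thm. B's hypothesis, Tate-module form),
# and bucket A of crux #3 from Yan–Zhu 2026 Thm. 5.7 (1) ALONE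

Route `UniversalToricDescent` (BirchSwinnertonDyer), `--supports` crux stmt-BirchSwinnertonDyer-23594
`TwinSplitIMCAtThreeGoodSSApZero` (sequel of `UniversalToricDescentTwinThreeAdicImageOverK`; also serves
20694 / the parent 20214 and the bucket-A pair 20692–20693). Namespace
`Summit.BirchSwinnertonDyer.BirchSwinnertonDyer.Theorems.ThreeAdicImageOverK`. THEOREMS ONLY (no
definition, no named fact). Seat bsd-wall-utd-p2 g9 (LEAD, «⊇-half only»).

* §1 `mem_range_galoisRepTate_of_forall_hasSurjectiveModNGaloisRep` — ANY field `F`, ANY `p`: if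
  `ρ̄_{E,pⁿ} : Γ_F → Aut(E[pⁿ])` is onto for every `n`, then EVERY `ℤ_p`-linear automorphism of the
  Tate module `T_pE` is `ρ_{E,p}(σ)` for some `σ ∈ Γ_F` (compactness of `Γ_F`, as in the tree's
  `exists_quotient_range_galoisRepTate_sub_one_equiv_of_forall_surjective` for the one matrix
  `(1 1; 0 1)`). This is the dictionary «levelwise onto ⟹ `Gal → Aut_{ℤ_p}(T)` onto», the latter
  being the form of the image hypothesis in the tree's `HowardHypotheses.surjective`
  (`HeegnerModuleIndex.lean`) and in the binder `hfull` of
  `UniversalToricDescentTwinSplit.twinSplit_instance_of_goodOrd_of_fullImage`.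
* §2 `isUnit_mem_range_galoisRepTate_baseChange_three_of_not_additive` — **for `E/ℚ` minimal, good
  or multiplicative at `3`, `ρ̄_{E,3}` onto, `K` quadratic with `3 ∤ d_K`: `Γ_K → Aut_{ℤ₃}(T₃E_K)` is
  onto** (previous file + §1); crux vocabulary `…_of_not_addv` (`¬ Addv W′ 3`, `IsImaginaryQuadratic K`,
  `3 ∈ 𝔭 ≠ 𝔭′ ∋ 3`).
* §3 `twinSplit_instance_of_goodOrd_of_yanZhu` — **bucket A (745 of the 2 023 twin classes): crux #3
  (i) ∧ (ii) verbatim at every frame on every good-ORDINARY twin with `ρ̄₃` onto and every Heegner `K`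
  with `3` split and `D_K` odd, from ONE refereed fact** — Yan–Zhu, J. Algebra 693 (2026), Thm. 5.7 (1)
  (integral clause, typed `YanZhu2026.thm57_isTorsion_charIdealXGr_eq_bdpLFunction`) — its full-image
  hypothesis now DISCHARGED by §2. Before: `twinSplit_instance_of_goodOrd` needed THREE facts (BCS 2025
  Thm. 4.2.1 (b) — whose integral clause at `p = 3` leans on BCK21 Thm. 5.2, standing `p > 3`, a
  referee-desk flag of the route — , Yan–Zhu 5.7 (1) rational clause, BCS 2025 Prop. 4.2.2), or
  `twinSplit_instance_of_goodOrd_of_fullImage` carried `hfull` as a binder ("censusable … not proved",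
  its docstring). PARTITION: unchanged in count (A 745 · B 675 · C 603); bucket A's print debt drops
  from {BCS 4.2.1(b), YZ 5.7(1), BCS 4.2.2} to {YZ 5.7(1)}. BSD is not proved by any of this.

## References
* [Howard2004] B. Howard, Compos. Math. 140 (2004), Thm. B (hypothesis «`Gal(K̄/K) → Aut_{ℤ_p}(T)` onto»).
* [YanZhu2024MainConjNonCM] X. Yan, X. Zhu, J. Algebra 693 (2026) 372–402, Thm. 5.7 (1).
* [Wuthrich2014] C. Wuthrich, Doc. Math. 19 (2014), Lemma 20. [SilvermanAEC2009] III.§7.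
-/

noncomputable section

open scoped Classical

set_option linter.dupNamespace false
set_option autoImplicit false

/-! ### §0 `ker (T_p A → A[p^n]) = p^n T_p A` -/

namespace Literature.NumberTheory.EllipticCurves.TateModule

variable {A : Type*} [AddCommGroup A] {p : ℕ} [Fact p.Prime]

/-- `ker (T_p A → A[p^n]) = p^n T_p A`: an element of the Tate module whose `n`-th component
vanishes is divisible by `p ^ n` (iterate `TateModule.p_smul_div`; same statement and proof as the
private `proj_ker_eq_pow_smul_aux` of `TateModuleBigImageOfSurjectiveProofs`). Silverman, *AEC*,
III.§7. [folklore] -/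
private theorem exists_eq_pow_smul_of_proj_eq_zero' (n : ℕ) (a : TateModule A p)
    (h : proj p n a = 0) : ∃ b : TateModule A p, a = ((p : ℤ_[p]) ^ n) • b := by
  induction n generalizing a with
  | zero => exact ⟨a, by rw [pow_zero, one_smul]⟩
  | succ n ih =>
    have h1 : proj p 1 a = 0 := by
      rw [← pow_smul_proj_self_add n 1 a, h, smul_zero]
    have hb : proj p n (div a h1) = 0 := by rw [proj_div]; exact h
    obtain ⟨c, hc⟩ := ih (div a h1) hb
    refine ⟨c, ?_⟩
    rw [← p_smul_div a h1, hc, smul_smul, pow_succ']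

end Literature.NumberTheory.EllipticCurves.TateModule

namespace Summit.BirchSwinnertonDyer.BirchSwinnertonDyer.Theorems.ThreeAdicImageOverK

open WeierstrassCurve Field Literature.NumberTheory.EllipticCurves
  Literature.NumberTheory.GaloisRepresentations

universe u

/-! ### §1 Levelwise surjectivity ⟹ every `ℤ_p`-automorphism of `T_pE` is a Galois element -/

section Tate

variable {F : Type u} [Field F] (W : WeierstrassCurve F) [W.IsElliptic] (p : ℕ) [Fact p.Prime]

/-- **Levelwise onto ⟹ onto `Aut_{ℤ_p}(T_pE)`.** For an elliptic curve `E/F` and a prime `p`: if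
`ρ̄_{E,pⁿ} : Γ_F → Aut(E[pⁿ])` is onto for every `n`, then every `ℤ_p`-linear automorphism `u` of
the Tate module `T_pE` is `ρ_{E,p}(σ)` for some `σ ∈ Γ_F` — i.e. `Γ_F → Aut_{ℤ_p}(T_pE)` is onto (the
form of the hypothesis of Howard 2004 Thm. B in the tree, `HowardHypotheses.surjective`). Proof as in
`exists_quotient_range_galoisRepTate_sub_one_equiv_of_forall_surjective` (the special `u = (1 1; 0 1)`
there): `u` descends to an automorphism of each `E[pⁿ] = π_n(T_pE)` (`ker π_n = pⁿT`, `π_n` onto),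
realised by some `σ_n`; the sets `{σ : σ ≡ u on E[pⁿ]}` are closed, non-empty and decreasing in the
compact `Γ_F`, so some `σ` lies in all of them. [cite: SilvermanAEC2009, III.§7]
[cite: Howard2004, Thm. B (hypothesis «Gal(K̄/K) → Aut_{ℤ_p}(T) surjective»)] -/
theorem mem_range_galoisRepTate_of_forall_hasSurjectiveModNGaloisRep
    (hsurj : ∀ n : ℕ, W.HasSurjectiveModNGaloisRep ((p ^ n : ℕ) : ℤ))
    (u : Module.End ℤ_[p] (W.tateModule p)) (hu : IsUnit u) :
    u ∈ Set.range (W.galoisRepTate p) := by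
  set T := W.tateModule p
  set U : T →ₗ[ℤ_[p]] T := u with hU
  set V : T →ₗ[ℤ_[p]] T := ((hu.unit⁻¹ : (Module.End ℤ_[p] T)ˣ) : Module.End ℤ_[p] T) with hV
  have hUV : ∀ t : T, U (V t) = t := fun t ↦ by
    have h := hu.unit.mul_inv
    rw [IsUnit.unit_spec] at h
    exact congrArg (fun f : Module.End ℤ_[p] T ↦ f t) h
  have hVU : ∀ t : T, V (U t) = t := fun t ↦ by
    have h := hu.unit.inv_mul
    rw [IsUnit.unit_spec] at h
    exact congrArg (fun f : Module.End ℤ_[p] T ↦ f t) h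
  -- the reduction maps `π n : T → E[p^n]`
  have hmem : ∀ (n : ℕ) (a : T), TateModule.proj p n a ∈ geomTorsion W (p ^ n : ℕ) :=
    fun n a ↦ proj_tateModule_mem_geomTorsion W p n a
  have hπsurj : ∀ (n : ℕ) (P : geomTorsion W (p ^ n : ℕ)), ∃ a : T, TateModule.proj p n a = P := by
    intro n P
    exact proj_surjective_of_isAlgClosed_holds W p n P.2
  -- `π_n (L a)` depends only on `π_n a`
  have hker : ∀ (n : ℕ) (L : T →ₗ[ℤ_[p]] T) (a a' : T),
      TateModule.proj p n a = TateModule.proj p n a' →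
        TateModule.proj p n (L a) = TateModule.proj p n (L a') := by
    intro n L a a' h
    have h0 : TateModule.proj p n (a - a') = 0 := by rw [map_sub, h, sub_self]
    obtain ⟨c, hc⟩ := TateModule.exists_eq_pow_smul_of_proj_eq_zero' n (a - a') h0
    have h1 : L a - L a' = ((p : ℤ_[p]) ^ n) • L c := by rw [← map_sub, hc, map_smul]
    rw [← sub_eq_zero, ← map_sub, h1, TateModule.proj_pow_smul, TateModule.pow_smul_proj]
  -- the induced automorphism `φ n` of `E[p^n]`
  have hφ : ∀ n : ℕ, ∃ φ : geomTorsion W (p ^ n : ℕ) ≃+ geomTorsion W (p ^ n : ℕ),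
      ∀ a : T, (φ ⟨TateModule.proj p n a, hmem n a⟩ : geomPoints W) = TateModule.proj p n (U a) := by
    intro n
    choose lift hlift using hπsurj n
    let f : geomTorsion W (p ^ n : ℕ) → geomTorsion W (p ^ n : ℕ) :=
      fun P ↦ ⟨TateModule.proj p n (U (lift P)), hmem n _⟩
    have hf' : ∀ P : geomTorsion W (p ^ n : ℕ), (f P : geomPoints W) =
        TateModule.proj p n (U (lift P)) := fun P ↦ rfl
    have hadd : ∀ P Q, f (P + Q) = f P + f Q := by
      intro P Q
      apply Subtype.ext
      have hPQ : TateModule.proj p n (lift P + lift Q) =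
          ((P + Q : geomTorsion W (p ^ n : ℕ)) : geomPoints W) := by
        rw [map_add, hlift, hlift]; rfl
      have := hker n U (lift (P + Q)) (lift P + lift Q) (by rw [hlift, hPQ])
      rw [hf', this, map_add, map_add]
      rfl
    let g : geomTorsion W (p ^ n : ℕ) → geomTorsion W (p ^ n : ℕ) :=
      fun P ↦ ⟨TateModule.proj p n (V (lift P)), hmem n _⟩
    have hfg : ∀ P, f (g P) = P := by
      intro P
      apply Subtype.ext
      have h1 : (f (g P) : geomPoints W) = TateModule.proj p n (U (V (lift P))) :=
        hker n U _ _ (hlift _)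
      rw [h1, hUV, hlift]
    have hgf : ∀ P, g (f P) = P := by
      intro P
      apply Subtype.ext
      have h1 : (g (f P) : geomPoints W) = TateModule.proj p n (V (U (lift P))) :=
        hker n V _ _ (hlift _)
      rw [h1, hVU, hlift]
    refine ⟨AddEquiv.mk ⟨f, g, hgf, hfg⟩ hadd, fun a ↦ ?_⟩
    exact hker n U _ _ (hlift _)
  choose φ hφ using hφ
  -- Galois elements realising `φ n`
  have hσn : ∀ n : ℕ, ∃ σ : absoluteGaloisGroup F,
      ∀ a : T, σ • TateModule.proj p n a = TateModule.proj p n (U a) := by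
    intro n
    obtain ⟨σ, hσ⟩ := hsurj n (Multiplicative.ofAdd (φ n))
    refine ⟨σ, fun a ↦ ?_⟩
    have h1 : ((Multiplicative.toAdd (galoisRepTorsion W _ σ)) ⟨TateModule.proj p n a, hmem n a⟩ :
        geomPoints W) = σ • TateModule.proj p n a := rfl
    rw [← h1, hσ, toAdd_ofAdd, hφ]
  -- the closed sets `S n`
  let S : ℕ → Set (absoluteGaloisGroup F) :=
    fun n ↦ {σ | ∀ a : T, σ • TateModule.proj p n a = TateModule.proj p n (U a)}
  haveI : ContinuousSMul (absoluteGaloisGroup F) (geomPoints W) := continuousSMul_geomPoints' W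
  have hSclosed : ∀ n, IsClosed (S n) := by
    intro n
    have : S n = ⋂ a : T, {σ | σ • TateModule.proj p n a = TateModule.proj p n (U a)} := by
      ext σ; simp [S]
    rw [this]
    refine isClosed_iInter fun a ↦ ?_
    exact isClosed_eq (continuous_id.smul continuous_const) continuous_const
  have hSne : ∀ n, (S n).Nonempty := fun n ↦ hσn n
  have hSmono : ∀ n, S (n + 1) ⊆ S n := by
    intro n σ hσ a
    have e1 : TateModule.proj p n a = p • TateModule.proj p (n + 1) a :=
      (TateModule.smul_proj_succ n a).symm
    have e2 : TateModule.proj p n (U a) = p • TateModule.proj p (n + 1) (U a) :=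
      (TateModule.smul_proj_succ n (U a)).symm
    rw [e1, e2, smul_comm, hσ a]
  haveI : CompactSpace (absoluteGaloisGroup F) := absoluteGaloisGroup_compactSpace F
  obtain ⟨σ, hσ⟩ := IsCompact.nonempty_iInter_of_sequence_nonempty_isCompact_isClosed S hSmono hSne
    (isClosed_univ.isCompact.of_isClosed_subset (hSclosed 0) (Set.subset_univ _)) hSclosed
  rw [Set.mem_iInter] at hσ
  -- `ρ_T(σ) = u`
  refine ⟨σ, LinearMap.ext fun a ↦ ?_⟩
  rw [galoisRepTate_apply_apply]
  exact TateModule.ext fun n ↦ by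
    rw [TateModule.proj_smul_of_distribMulAction]; exact hσ n a

end Tate

/-! ### §2 Howard's image hypothesis at `p = 3` over `K`, in the tree's `HowardHypotheses.surjective` form -/

section OverK

open NumberField IsDedekindDomain Literature.NumberTheory.EllipticCurves.Rank1Residual

/-- **`Γ_K → Aut_{ℤ₃}(T₃E_K)` is onto** — the field `surjective` of the tree's `HowardHypotheses`
(Howard 2004 Thm. B) and the binder `hfull` of `twinSplit_instance_of_goodOrd_of_fullImage`
(Yan–Zhu 2026 Thm. 5.7 (1), integral clause) — for `E/ℚ` minimal, good or multiplicative at `3`,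
`ρ̄_{E,3}` onto, and `K` quadratic with `3 ∤ d_K`: every `ℤ₃`-linear automorphism of the Tate module
of `E_K` is a Galois element (`forall_hasSurjectiveModNGaloisRep_three_pow_baseChange_of_not_additive`
+ `mem_range_galoisRepTate_of_forall_hasSurjectiveModNGaloisRep`).
[cite: Howard2004, Thm. B (hypothesis)] [cite: Wuthrich2014, Lemma 20 (p. 399)] -/
theorem isUnit_mem_range_galoisRepTate_baseChange_three_of_not_additive (W : WeierstrassCurve ℚ)
    [W.IsElliptic] [W.IsGloballyMinimal] (K : Type) [Field K] [NumberField K]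
    (h2 : Module.finrank ℚ K = 2) (hd : ¬ (3 : ℤ) ∣ NumberField.discr K)
    (hred : W.HasGoodReductionAtPrime 3 ∨ W.HasMultiplicativeReductionAtPrime 3)
    (hsurj : W.HasSurjectiveModNGaloisRep 3) :
    ∀ u : Module.End ℤ_[3] ((W.baseChange K).tateModule 3), IsUnit u →
      u ∈ Set.range (galoisRepTate (W.baseChange K) 3) := by
  haveI : Fact (Nat.Prime 3) := ⟨Nat.prime_three⟩
  intro u hu
  exact mem_range_galoisRepTate_of_forall_hasSurjectiveModNGaloisRep (W.baseChange K) 3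
    (forall_hasSurjectiveModNGaloisRep_three_pow_baseChange_of_not_additive W K h2 hd hred hsurj) u hu

/-- Crux vocabulary: the same for every twin of the UTD cell (`¬ Addv W′ 3`) and every imaginary
quadratic `K` with two primes `𝔭 ≠ 𝔭′` above `3`. [cite: Howard2004, Thm. B (hypothesis)]
[cite: Wuthrich2014, Lemma 20 (p. 399)] -/
theorem isUnit_mem_range_galoisRepTate_baseChange_three_of_not_addv (W' : WeierstrassCurve ℚ)
    [W'.IsElliptic] [W'.IsGloballyMinimal] (K : Type) [Field K] [NumberField K]
    (hred : ¬ Addv W' 3) (hsurj : W'.HasSurjectiveModNGaloisRep 3) (hK : IsImaginaryQuadratic K)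
    {𝔭 𝔭' : HeightOneSpectrum (𝓞 K)} (h𝔭 : ((3 : ℕ) : 𝓞 K) ∈ 𝔭.asIdeal)
    (h𝔭' : ((3 : ℕ) : 𝓞 K) ∈ 𝔭'.asIdeal) (hne : 𝔭' ≠ 𝔭) :
    ∀ u : Module.End ℤ_[3] ((W'.baseChange K).tateModule 3), IsUnit u →
      u ∈ Set.range (galoisRepTate (W'.baseChange K) 3) := by
  have hred' : W'.HasGoodReductionAtPrime 3 ∨ W'.HasMultiplicativeReductionAtPrime 3 := by
    by_contra h
    exact hred ⟨fun hg ↦ h (Or.inl hg), fun hm ↦ h (Or.inr hm)⟩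
  exact isUnit_mem_range_galoisRepTate_baseChange_three_of_not_additive W' K hK.1
    (not_three_dvd_discr_of_ne hK.1 h𝔭 h𝔭' hne) hred' hsurj

end OverK

/-! ### §3 Bucket A of crux #3 from ONE refereed fact: Yan–Zhu 2026 Thm. 5.7 (1), integral clause,
with its full-image hypothesis DISCHARGED -/

section BucketA

open PowerSeries NumberField IsDedekindDomain
  Literature.NumberTheory.EllipticCurves.ModularForms
  Literature.NumberTheory.EllipticCurves.Rank1Residual
  Summit.BirchSwinnertonDyer.Rank1Residual.X11b
  Summit.BirchSwinnertonDyer.Rank1Residual.X11b.Halves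
  Summit.BirchSwinnertonDyer.BirchSwinnertonDyer.Theorems.SchneiderFree
  Summit.BirchSwinnertonDyer.BirchSwinnertonDyer.Theorems.UniversalToricDescentTwinSplit

/-- **Crux #3 `TwinSplitIMCAtThree` — conjuncts (i) ∧ (ii) VERBATIM, at EVERY frame — on every
good-ORDINARY twin with `ρ̄₃` onto over `ℚ` and every Heegner `K` with `3 = 𝔭𝔭′` split and `D_K`
odd, CONDITIONAL on ONE refereed fact: Yan–Zhu 2026 Thm. 5.7 (1) (`h57`, integral clause).** This is
`twinSplit_instance_of_goodOrd_of_fullImage` (p-ids in `UniversalToricDescentTwinSplitIMCAtThreeGoodOrdOfYanZhu`)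
with its binder `hfull` («every `ℤ₃`-automorphism of `T₃(W′_K)` is a Galois element») now PROVED
(`isUnit_mem_range_galoisRepTate_baseChange_three_of_not_additive`): bucket A (745 of the 2 023 twin
classes) needs neither BCS 2025 Thm. 4.2.1 (b) (and its BCK21 `p > 3` provenance flag) nor BCS 2025
Prop. 4.2.2 any more — compare `twinSplit_instance_of_goodOrd` (three facts). BSD is not proved by this.
[cite: YanZhu2024MainConjNonCM, Thm. 5.7 (1) (§5.2; J. Algebra 693 (2026))] [cite: Wuthrich2014, Lemma 20 (p. 399)] -/
theorem twinSplit_instance_of_goodOrd_of_yanZhu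
    (h57 : YanZhu2026.thm57_isTorsion_charIdealXGr_eq_bdpLFunction)
    (W' : WeierstrassCurve ℚ) [W'.IsElliptic] [W'.IsGloballyMinimal] (N' : ℕ) [NeZero N']
    (K : Type) [Field K] [NumberField K] (Dt' : ModularParametrizationData W' N')
    (hord : GoodOrd W' 3) (hsurj : W'.HasSurjectiveModNGaloisRep 3)
    (hK : IsImaginaryQuadratic K) (hH : SatisfiesHeegnerHypothesis N' K)
    (hodd : Odd (NumberField.discr K))
    (κ : ZpExtension K 3) (hκ : κ.IsAnticyclotomic) (γ : absoluteGaloisGroup K)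
    [hγ : Fact (κ.IsTopGenerator γ)]
    (𝔭 : HeightOneSpectrum (𝓞 K)) (h𝔭 : ((3 : ℕ) : 𝓞 K) ∈ 𝔭.asIdeal)
    (he : 𝔭.asIdeal.ramificationIdx (𝓞 ℚ) = 1) (hf : 𝔭.asIdeal.inertiaDeg (𝓞 ℚ) = 1)
    (𝔭' : HeightOneSpectrum (𝓞 K)) (h𝔭' : ((3 : ℕ) : 𝓞 K) ∈ 𝔭'.asIdeal) (hne : 𝔭' ≠ 𝔭)
    (ι' : PadicAlgCl 3 ≃+* ℂ) (hι' : BranchInducesPrime 3 ι' 𝔭) :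
    (∃ (ΩK : ℂ) (Ωp : ℂ_[3]) (L' : UnrSeries 3), ΩK ≠ 0 ∧ Ωp ≠ 0 ∧
        IsBDPLFunction ι' 𝔭 κ γ Dt'.f ΩK Ωp L') ∧
      (∀ (ΩK : ℂ) (Ωp : ℂ_[3]) (L' : UnrSeries 3), ΩK ≠ 0 → Ωp ≠ 0 →
        IsBDPLFunction ι' 𝔭 κ γ Dt'.f ΩK Ωp L' →
        (AcSelmer.XAc.charIdeal (W'.baseChange K) 3 κ 𝔭' ∅ γ).map (PowerSeries.map (toUnr 3)) =
          Ideal.span {L'}) :=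
  twinSplit_instance_of_goodOrd_of_fullImage h57 W' N' K Dt' hord hsurj
    (isUnit_mem_range_galoisRepTate_baseChange_three_of_not_additive W' K hK.1
      (not_three_dvd_discr_of_ne hK.1 h𝔭 h𝔭' hne) (Or.inl hord.1) hsurj)
    hK hH hodd κ hκ γ 𝔭 h𝔭 he hf 𝔭' h𝔭' hne ι' hι'

end BucketA

/-! ### §4 Bucket A in the ROUTE's currency: `YanZhu 5.7 (1) → ` the conclusion of `TwinSplitIMCAtThreeGoodOrdOfPrint` -/

section BucketARoute

open Summit.BirchSwinnertonDyer.BirchSwinnertonDyer.Theorems.UniversalToricDescentTwinSplit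

/-- **The route's bucket-A statement from ONE printed fact.** The route file's support decl
`TwinSplitIMCAtThreeGoodOrdOfPrint` (stmt-BirchSwinnertonDyer-20693, closed) reads
`BCS25 Thm 4.2.1(b) → YanZhu26 Thm 5.7(1) → BCS25 Prop 4.2.2 → S_A` with `S_A` = crux #3 on the
good-ordinary twins VERBATIM (odd `d_K`); this theorem is **`YanZhu26 Thm 5.7(1) → S_A`** with the SAME
`S_A` spelled out — a turnkey for the pen to re-key the print-debt item 20692 `TwinSplitIMCAtThreePrintedFacts`
(a 3-fact conjunction) to the single fact. [cite: YanZhu2024MainConjNonCM, Thm. 5.7 (1) (§5.2; J. Algebra 693 (2026))]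
[cite: Wuthrich2014, Lemma 20 (p. 399)] -/
theorem twinSplitIMCAtThreeGoodOrd_of_yanZhu57
    (h57 : Literature.NumberTheory.EllipticCurves.YanZhu2026.thm57_isTorsion_charIdealXGr_eq_bdpLFunction) :
    ∀ (W' : WeierstrassCurve ℚ) [W'.IsElliptic] [W'.IsGloballyMinimal] (N' : ℕ) [NeZero N'] (K : Type) [Field K] [NumberField K] (Dt' : Literature.NumberTheory.EllipticCurves.ModularForms.ModularParametrizationData W' N'), Literature.NumberTheory.EllipticCurves.Rank1Residual.GoodOrd W' 3 → W'.HasSurjectiveModNGaloisRep 3 → W'.conductorNorm ℤ = N' → Literature.NumberTheory.EllipticCurves.IsImaginaryQuadratic K → Literature.NumberTheory.EllipticCurves.SatisfiesHeegnerHypothesis N' K → Odd (NumberField.discr K) → ∀ (κ : Literature.NumberTheory.EllipticCurves.ZpExtension K 3), κ.IsAnticyclotomic → ∀ (γ : Field.absoluteGaloisGroup K) [Fact (κ.IsTopGenerator γ)] (𝔭 : IsDedekindDomain.HeightOneSpectrum (NumberField.RingOfIntegers K)), ((3 : ℕ) : NumberField.RingOfIntegers K) ∈ 𝔭.asIdeal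 → 𝔭.asIdeal.ramificationIdx (NumberField.RingOfIntegers ℚ) = 1 → 𝔭.asIdeal.inertiaDeg (NumberField.RingOfIntegers ℚ) = 1 → ∀ (𝔭' : IsDedekindDomain.HeightOneSpectrum (NumberField.RingOfIntegers K)), ((3 : ℕ) : NumberField.RingOfIntegers K) ∈ 𝔭'.asIdeal → 𝔭' ≠ 𝔭 → ∀ (ι' : PadicAlgCl 3 ≃+* ℂ), Summit.BirchSwinnertonDyer.BirchSwinnertonDyer.Theorems.SchneiderFree.BranchInducesPrime 3 ι' 𝔭 → (∃ (ΩK : ℂ) (Ωp : ℂ_[3]) (L' : Literature.NumberTheory.EllipticCurves.UnrSeries 3), ΩK ≠ 0 ∧ Ωp ≠ 0 ∧ Literature.NumberTheory.EllipticCurves.IsBDPLFunction ι' 𝔭 κ γ Dt'.f ΩK Ωp L') ∧ (∀ (ΩK : ℂ) (Ωp : ℂ_[3]) (L' : Literature.NumberTheory.EllipticCurves.UnrSeries 3), ΩK ≠ 0 → Ωp ≠ 0 → Literature.NumberTheory.EllipticCurves.IsBDPLFunction ι' 𝔭 κ γ Dt'.f ΩK Ωp L' → (Summit.BirchSwinnertonDyer.Rank1Residual.X11b.AcSelmer.XAc.charIdeal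 (W'.baseChange K) 3 κ 𝔭' ∅ γ).map (PowerSeries.map (Summit.BirchSwinnertonDyer.Rank1Residual.X11b.Halves.toUnr 3)) = Ideal.span {L'}) := by
  intro W' _ _ N' _ K _ _ Dt' hord hsurj _hN hK hH hodd κ hκ γ _ 𝔭 h𝔭 he hf 𝔭' h𝔭' hne ι' hι'
  exact twinSplit_instance_of_goodOrd_of_yanZhu h57 W' N' K Dt' hord hsurj hK hH hodd κ hκ γ 𝔭 h𝔭 he hf
    𝔭' h𝔭' hne ι' hι'

end BucketARoute

end Summit.BirchSwinnertonDyer.BirchSwinnertonDyer.Theorems.ThreeAdicImageOverK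

end
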